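import Summits.BirchSwinnertonDyer.BirchSwinnertonDyer.Theorems.Rank1ResidualJetKolyvaginClassStringent
import Summits.BirchSwinnertonDyer.BirchSwinnertonDyer.Theorems.Rank1ResidualJetThm63KernelInputsV3
import Summits.BirchSwinnertonDyer.BirchSwinnertonDyer.Theorems.Rank1ResidualJetThm63LocalFactsPrime
import Literature.NumberTheory.NumberFields.PureCubicGenusDivisorLemmas
import Literature.NumberTheory.EllipticCurves.HeegnerPointsOfConductorRationalityProofs
import Literature.NumberTheory.EllipticCurves.RingClassGalOverCyclicProofs
import HarnessLib

/-!
# T1 JET (cell `bsd-jet`), road K, K-GAP-2 (`h49str`): `loc_v c_k(c) ∈ 𝒮_v` at every `v ∤ c` with the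
# [GZ86 III (3.1)] input `hGZ` KOLYVAGIN-SCOPED (the v3 chain's `HGZKolyvagin` shape)

HONEST FRAMING (programme file §HONESTY, verbatim): «no tranche here proves BSD; ARM L moves the
LITERAL column of an r ≤ 1 census into the kernel-proved-modulo-named-print column.» THEOREMS ONLY
(seat `bsd-jet-pv-1`, session g7; `--supports stmt-BirchSwinnertonDyer-14418`, helper); 0 classes
move. WHAT THIS IS. `JET.localization_kolyvaginClass_mem_stringentFamily_of_GZ31` (sibling
`…KolyvaginClassStringent`, p532810) asks its input `hGZ` ([GZ86 III (3.1)] receptacle schema) at EVERY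
conductor `m`. pv-2's v3 re-threading of the H63 line (p533468 `…Thm63KernelInputsV3`, INBOX
2026-08-27T12:42:16Z) carries `hGZ` in read-1's m-GUARDED shape — asked only at square-free `m` whose
prime factors are Zhang–Kolyvagin primes (the only conductors at which the chain uses it). This file is
the same theorem with that WEAKER hypothesis: `localization_kolyvaginClass_mem_stringentFamily_of_GZ31_kolyvagin`
(proof identical; at the divisors `m ∣ c` the guard is `hc.squarefree_of_dvd hm` and
`Nat.primeFactors_mono`; the Kummer places go through pv-2's `…_of_GZ31_kolyvagin`; the Gross §3 CM
facts are the tree's `_holds` theorems), and its carrier-pair corollary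
`localization_kolyvaginClass_mem_stringentFamily_carrier_kolyvagin` = the binder `h49str` of pv-2's
`_of_localFactsPrime_v3` IN FRAME (carrier places lie over `N`, Kolyvagin conductors are prime to `N`).
References: [cite: Jetchev2008, Def. 4.8, Prop. 4.9 (arXiv) = Prop. 4.1 (pp. 819–821), §3.1 (p. 814)]
[cite: GrossLMS1991, §6 Prop. 6.2 (1)] [cite: GrossZagier1986, III (3.1)] [cite: MilneADT2006, Ch. I Prop. 3.8].
-/

set_option autoImplicit false

noncomputable section

open scoped Classical Pointwise
open WeierstrassCurve Field NumberField IsDedekindDomain Finset Literature.NumberTheory.Automorphic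
open Literature.NumberTheory.EllipticCurves Literature.NumberTheory.GaloisRepresentations
open Literature.NumberTheory.EllipticCurves.KolyvaginCocycle Literature.NumberTheory.EllipticCurves.KolyvaginEuler
open Literature.NumberTheory.EllipticCurves.RingClassField Literature.NumberTheory.EllipticCurves.ModularForms
open Summit.BirchSwinnertonDyer.Rank1Residual.X11b Summit.BirchSwinnertonDyer.Rank1Residual.X11b.Three
open Summit.BirchSwinnertonDyer.Rank1Residual.X11b.Three.GrossBadPlace
open Summit.BirchSwinnertonDyer.Rank1Residual.X11b.KolyvaginHloc

namespace Summit.BirchSwinnertonDyer.Rank1Residual.JET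

-- `K : Type`: the tree's ring-class class field theory is universe `0`.
variable {K : Type} [Field K] [NumberField K] {W : WeierstrassCurve ℚ}

/-- **K-GAP-2 `h49str` in the `H63` binder currency, `hGZ` KOLYVAGIN-SCOPED (read-1's `HGZKolyvagin` shape,
pv-2's v3 chain): `loc_v c_k(c) ∈ 𝒮_v` at EVERY place `v ∤ c`**
(`𝒮 = JET.stringentFamily W K hn`, Jetchev's stringent Kummer structure of Def. 4.8 / §3.1 read on
x11b3's connected Kummer condition). For `E/ℚ` globally minimal with `ρ̄_{E,p}` onto at an odd `p`,
`K` imaginary quadratic with `d_K ∉ {−3, −4}` and the Heegner hypothesis for `N = N_E`, a frame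
`(Dt, β, ι)`, `c ∈ Λ` with prime factors of index `≥ k`, ANY datum `d` of conductor `c`, and a place `v`
not over a prime factor of `c`: complex `v` — `H¹(ℂ, ·) = 0`; finite `v` with non-minimal base change —
`𝒮_v = Kum_v` by definition; finite good `v` with minimal base change — `Kum⁰ = Kum` (`E₀ = E`);
these three by pv-2's `localization_kolyvaginClass_mem_kummerSelmerStructure_of_GZ31_kolyvagin` (p533468); finite BAD `v`
with minimal base change — the stringent chain (`…_concrete_of_GZ31_zhang` above, then
`Receptacle.mem_goodReductionSubgroup_of_mem_E0Receptacle`). GIVEN: `hGZ` = [GZ86 III (3.1)] in the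
receptacle form asked ONLY at square-free `m` with Zhang–Kolyvagin prime factors (at the divisors `m ∣ c` the
guard is `hc.squarefree_of_dvd` / `Nat.primeFactors_mono`), `n′` prime to `p`; the Gross §3 CM facts are the
tree's `_holds` theorems.
[cite: Jetchev2008, Def. 4.8, Prop. 4.9; §3.1 (p. 814)] [cite: GrossLMS1991, §6 Prop. 6.2 (1)]
[cite: GrossZagier1986, III (3.1)] -/
theorem localization_kolyvaginClass_mem_stringentFamily_of_GZ31_kolyvagin [W.IsElliptic] [W.IsGloballyMinimal]
    [NeZero (W.conductorNorm ℤ)]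
    (hK : IsImaginaryQuadratic K) (hD3 : NumberField.discr K ≠ -3) (hD4 : NumberField.discr K ≠ -4)
    (hH : SatisfiesHeegnerHypothesis (W.conductorNorm ℤ) K)
    {p : ℕ} [Fact p.Prime] (hp2 : p ≠ 2) (hρ : W.HasSurjectiveModNGaloisRep p)
    (Dt : ModularParametrizationData W (W.conductorNorm ℤ)) (β : ℤ) (ι : K →+* ℂ)
    {n' : ℤ} (hcop' : IsCoprime (p : ℤ) n')
    (hGZ : ∀ (m : ℕ), Squarefree m →
      (∀ q ∈ m.primeFactors, Zhang2014.IsKolyvaginPrime (W.conductorNorm ℤ) W K p q) →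
      ∀ (dm : KolyvaginHeegnerData Dt β ι m)
      (γ : ringClassField K ι m ≃ₐ[ℚ] ringClassField K ι m), γ ∈ ringClassGal ι m →
      ∀ v : HeightOneSpectrum (𝓞 K), ¬ (W.baseChange K).HasGoodReductionAt v →
        n' • pointsMap (W.baseChange K) (v.adicCompletion K)
            (dm.toGeomPoints (pointGalHom W (ringClassField K ι m) γ dm.y)) ∈
          E0Receptacle (W.baseChange K) v ∧
        ∀ (ℓ : ℕ), ℓ ∈ m.primeFactors → ∀ (dm' : KolyvaginHeegnerData Dt β ι (m / ℓ))
          (hle : ringClassField K ι (m / ℓ) ≤ ringClassField K ι m),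
          n' • pointsMap (W.baseChange K) (v.adicCompletion K)
              (dm.toGeomPoints (pointGalHom W (ringClassField K ι m) γ
                (WeierstrassCurve.Affine.Point.map (W' := W)
                  ((RingClassField.inclusion ι hle).restrictScalars ℚ) dm'.y))) ∈
            E0Receptacle (W.baseChange K) v)
    {c : ℕ} (hc : Squarefree c) {k : ℕ} (hn : ((p ^ k : ℕ) : ℤ) ≠ 0)
    (hcK : ∀ ℓ ∈ c.primeFactors, Zhang2014.IsKolyvaginPrime (W.conductorNorm ℤ) W K p ℓ ∧
      k ≤ Zhang2014.kolyvaginIndex W p ℓ)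
    (d : KolyvaginHeegnerData Dt β ι c) [∀ j : ℕ, NumberField (ringClassField K ι j)]
    (v : Place K) (hv : ∀ ℓ ∈ c.primeFactors, ¬ Jetchev2008.PlaceOver K v ℓ) :
    galoisCohomology.localization ((W.baseChange K).torsionGaloisModule ((p ^ k : ℕ) : ℤ)) v 1
        (d.kolyvaginClass (Fact.out : p.Prime) k) ∈ stringentFamily W K hn v := by
  have hp : p.Prime := Fact.out
  -- the Kummer condition at `v` (pv-2), used at complex / non-minimal / good places
  have hKum := localization_kolyvaginClass_mem_kummerSelmerStructure_of_GZ31_kolyvagin hK hD3 hD4 hH hp2 hρ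
    Dt β ι hcop' hGZ hc hcK d v hv
  rcases v with w | 𝔳
  · -- complex place: the stringent family IS the Kummer condition there
    exact hKum
  · by_cases hmin : ((W.baseChange K).baseChange (𝔳.adicCompletion K)).IsMinimal (𝔳.adicCompletionIntegers K)
    swap
    · -- non-minimal base change: `𝒮_v = Kum_v` by definition
      rw [show stringentFamily W K hn (Sum.inr 𝔳) =
          (W.baseChange K).kummerSelmerStructure ((p ^ k : ℕ) : ℤ) (Sum.inr 𝔳) by
        simp only [stringentFamily, dif_neg hmin]]
      exact hKum
    haveI := hmin
    haveI : CharZero (𝔳.adicCompletion K) :=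
      charZero_of_injective_algebraMap (algebraMap K _).injective
    rw [stringentFamily_inr_of_isMinimal W K hn 𝔳]
    by_cases hgood : (W.baseChange K).HasGoodReductionAt 𝔳
    · -- good minimal place: `E₀(K_v) = E(K_v)`, so `Kum⁰ = Kum`
      haveI : ((W.baseChange K).baseChange (𝔳.adicCompletion K)).HasGoodReduction
          (𝔳.adicCompletionIntegers K) :=
        (hasGoodReduction_iff_of_isMinimal_of_eq_smul (𝔳.adicCompletionIntegers K)
          (rfl : (W.baseChange K).localMinimalModel 𝔳 =
            (((W.baseChange K).baseChange (𝔳.adicCompletion K)).exists_isMinimal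
              (𝔳.adicCompletionIntegers K)).choose • (W.baseChange K).baseChange (𝔳.adicCompletion K))).mp
          hgood
      rw [X11b.Three.JetchevKummer.connectedKummerCondition_eq_of_goodReductionSubgroup_eq_top
        (W.baseChange K) (𝔳.adicCompletion K) (𝔳.adicCompletionIntegers K) hn
        (WeierstrassCurve.goodReductionSubgroup_eq_top_of_hasGoodReduction
          (𝔳.adicCompletionIntegers K) _)]
      rw [WeierstrassCurve.kummerSelmerStructure_apply] at hKum
      exact hKum
    -- BAD minimal place: the stringent chain
    have hcv : (c : 𝓞 K) ∉ 𝔳.asIdeal := fun h ↦ by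
      obtain ⟨ℓ, hℓ, hℓv⟩ := exists_primeFactor_mem_of_natCast_mem hc 𝔳 h
      exact hv ℓ hℓ ⟨𝔳, rfl, hℓv⟩
    have hND : IsCoprime (W.conductorNorm ℤ : ℤ) (NumberField.discr K) :=
      KolyvaginAssembly.isCoprime_discr_of_satisfiesHeegnerHypothesis hK hH
    have hD : NumberField.discr K < -4 := KolyvaginAssembly.discr_lt_neg_four hK ⟨hD3, hD4⟩
    have hinert : ∀ (m' : ℕ), m' ∣ c → ∀ q ∈ m'.primeFactors, (Ideal.span {(q : 𝓞 K)}).IsPrime :=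
      fun m' hm' q hq ↦ (hcK q (Nat.primeFactors_mono hm' hc.ne_zero hq)).1.2.2.2.2.1
    -- data at every divisor of `c` (the given `d` at `c` itself)
    have hne : ∀ m' : ℕ, m' ∣ c → Nonempty (KolyvaginHeegnerData Dt β ι m') := fun m' hm' ↦
      BirchSwinnertonDyer.Theorems.nonempty_kolyvaginHeegnerData_of_grossCM
        (phi_heegnerPointOfConductor_mem_range_map_ringClassField_holds (W.conductorNorm ℤ) W K)
        exists_generator_ringClassGalOver_holds hK hH Dt β ι
        d.dvd_sq_sub (hc.squarefree_of_dvd hm') (hinert m' hm')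
    let data : (m' : ℕ) → m' ∣ c → KolyvaginHeegnerData Dt β ι m' := fun m' hm' ↦
      if h : m' = c then h ▸ d else (hne m' hm').some
    have hdata : data c dvd_rfl = d := by simp [data]
    have hcop : IsCoprime ((p ^ k : ℕ) : ℤ) n' := by
      rw [Nat.cast_pow]; exact IsCoprime.pow_left hcop'
    obtain ⟨t, htE, ht⟩ := exists_localKummerMap_eq_res_kolyvaginClass_concrete_of_GZ31_zhang hK ι hp Dt
      hND hD hc hcK data hcop
      (fun m hm γ hγ v hbad ↦
        ⟨(hGZ m (hc.squarefree_of_dvd hm) (fun q hq ↦ (hcK q (Nat.primeFactors_mono hm hc.ne_zero hq)).1)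
            (data m hm) γ hγ v hbad).1,
          fun ℓ hℓ hle ↦ (hGZ m (hc.squarefree_of_dvd hm)
            (fun q hq ↦ (hcK q (Nat.primeFactors_mono hm hc.ne_zero hq)).1) (data m hm) γ hγ v hbad).2
            ℓ hℓ _ hle⟩)
      (fun m hm ↦ RingClassNoTorsion.isAdmissible_pointsSubgroup _ hK
        (ne_zero_of_dvd_ne_zero hc.ne_zero hm) hp hp2 hρ k) hn c dvd_rfl 𝔳 hcv hgood
    rw [hdata] at ht
    -- `e(t) ∈ E⁰(K̄_v)` and `t` rational ⇒ `t ∈ E₀(K_v)` (B); `loc_v c = δ_v(t)`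
    exact (X11b.Three.JetchevKummer.mem_connectedKummerCondition_iff (W.baseChange K) (𝔳.adicCompletion K)
      (𝔳.adicCompletionIntegers K) hn _).mpr
      ⟨t, Receptacle.mem_goodReductionSubgroup_of_mem_E0Receptacle (W.baseChange K) 𝔳 t htE, ht⟩

/-- **K-GAP-2 `h49str` IN FRAME, `hGZ` KOLYVAGIN-SCOPED (v3 frame): `loc_q c_k(cℓ) ∈ 𝒮_q` at the
carrier pair `q ∈ {v₀, τ•v₀}`**
(Jetchev 2008 Prop. 4.9 proper = printed Prop. 4.1 at the places over the carrier prime). From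
`localization_kolyvaginClass_mem_stringentFamily_of_GZ31_kolyvagin` (every place not over `cℓ`):
`v₀` and `τ•v₀` lie over `N`, and a Kolyvagin conductor is prime to `N`. Inputs: the H63 frame's `hGZ`
([GZ86 III (3.1)] receptacle schema, cite-only) with `n′` prime to `p`, `ρ̄_{E,p}` onto, `d_K ∉ {−3,−4}`,
the Heegner hypothesis; the Gross §3 CM facts are the tree's `_holds` theorems.
[cite: Jetchev2008, Prop. 4.9 (arXiv) = Prop. 4.1 (pp. 819–821)] [cite: GrossZagier1986, III (3.1)] -/
theorem localization_kolyvaginClass_mem_stringentFamily_carrier_kolyvagin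
    (W : WeierstrassCurve ℚ) [W.IsElliptic] [W.IsGloballyMinimal] [NeZero (W.conductorNorm ℤ)]
    (K : Type) [Field K] [NumberField K] (hK : IsImaginaryQuadratic K)
    (hD3 : NumberField.discr K ≠ -3) (hD4 : NumberField.discr K ≠ -4)
    (hH : SatisfiesHeegnerHypothesis (W.conductorNorm ℤ) K)
    {p : ℕ} [Fact p.Prime] (hp2 : p ≠ 2) (hρ : W.HasSurjectiveModNGaloisRep p)
    (Dt : ModularParametrizationData W (W.conductorNorm ℤ)) (β : ℤ) (ι : K →+* ℂ)
    [∀ j : ℕ, NumberField (ringClassField K ι j)]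
    {n' : ℤ} (hcop' : IsCoprime (p : ℤ) n')
    (hGZ : ∀ (m : ℕ), Squarefree m →
      (∀ q ∈ m.primeFactors, Zhang2014.IsKolyvaginPrime (W.conductorNorm ℤ) W K p q) →
      ∀ (dm : KolyvaginHeegnerData Dt β ι m)
      (γ : ringClassField K ι m ≃ₐ[ℚ] ringClassField K ι m), γ ∈ ringClassGal ι m →
      ∀ v : HeightOneSpectrum (𝓞 K), ¬ (W.baseChange K).HasGoodReductionAt v →
        n' • pointsMap (W.baseChange K) (v.adicCompletion K)
            (dm.toGeomPoints (pointGalHom W (ringClassField K ι m) γ dm.y)) ∈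
          E0Receptacle (W.baseChange K) v ∧
        ∀ (ℓ : ℕ), ℓ ∈ m.primeFactors → ∀ (dm' : KolyvaginHeegnerData Dt β ι (m / ℓ))
          (hle : ringClassField K ι (m / ℓ) ≤ ringClassField K ι m),
          n' • pointsMap (W.baseChange K) (v.adicCompletion K)
              (dm.toGeomPoints (pointGalHom W (ringClassField K ι m) γ
                (WeierstrassCurve.Affine.Point.map (W' := W)
                  ((RingClassField.inclusion ι hle).restrictScalars ℚ) dm'.y))) ∈
            E0Receptacle (W.baseChange K) v)
    (τ : K ≃ₐ[ℚ] K) {k : ℕ} (hn : ((p ^ k : ℕ) : ℤ) ≠ 0) {c : ℕ} (hc : Squarefree c)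
    (hcK : ∀ ℓ ∈ c.primeFactors, Zhang2014.IsKolyvaginPrime (W.conductorNorm ℤ) W K p ℓ ∧
      k ≤ Zhang2014.kolyvaginIndex W p ℓ)
    (v₀ : HeightOneSpectrum (𝓞 K)) (hv₀N : ((W.conductorNorm ℤ : ℕ) : 𝓞 K) ∈ v₀.asIdeal) :
    ∀ (ℓ : ℕ), Zhang2014.IsKolyvaginPrime (W.conductorNorm ℤ) W K p ℓ →
      k ≤ Zhang2014.kolyvaginIndex W p ℓ → ℓ ∉ c.primeFactors →
      ∀ (d' : KolyvaginHeegnerData Dt β ι (c * ℓ)), ∀ q ∈ ({v₀, τ • v₀} : Finset _),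
      galoisCohomology.localization ((W.baseChange K).torsionGaloisModule ((p ^ k : ℕ) : ℤ))
          (Sum.inr q) 1 (d'.kolyvaginClass (Fact.out : p.Prime) k) ∈ stringentFamily W K hn (Sum.inr q) := by
  intro ℓ hℓK hkℓ hℓc d' q hq
  have hc0 : c ≠ 0 := hc.ne_zero
  have hℓp : ℓ.Prime := hℓK.1
  -- `cℓ` is a square-free Kolyvagin conductor of index `≥ k`
  have hℓdvd : ¬ ℓ ∣ c := fun h ↦ hℓc (Nat.mem_primeFactors.mpr ⟨hℓp, h, hc0⟩)
  have hcℓ : Squarefree (c * ℓ) :=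
    (Nat.squarefree_mul ((Nat.coprime_comm.mp ((Nat.Prime.coprime_iff_not_dvd hℓp).mpr hℓdvd)))).mpr
      ⟨hc, hℓp.squarefree⟩
  have hcℓK : ∀ ℓ' ∈ (c * ℓ).primeFactors, Zhang2014.IsKolyvaginPrime (W.conductorNorm ℤ) W K p ℓ' ∧
      k ≤ Zhang2014.kolyvaginIndex W p ℓ' := by
    intro ℓ' hℓ'
    rw [Nat.primeFactors_mul hc0 hℓp.ne_zero, Finset.mem_union, hℓp.primeFactors, Finset.mem_singleton] at hℓ'
    rcases hℓ' with h | rfl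
    · exact hcK ℓ' h
    · exact ⟨hℓK, hkℓ⟩
  -- the carrier pair lies over `N`, hence over no prime factor of `cℓ` (all prime to `N`)
  have hqN : ((W.conductorNorm ℤ : ℕ) : 𝓞 K) ∈ q.asIdeal := by
    simp only [Finset.mem_insert, Finset.mem_singleton] at hq
    rcases hq with rfl | rfl
    · exact hv₀N
    · have := (HeightOneSpectrum.smul_mem_smul_asIdeal_iff τ v₀ ((W.conductorNorm ℤ : ℕ) : 𝓞 K)).mpr hv₀N
      rwa [GlobalDuality.smul_natCast_ringOfIntegers] at this
  have hv : ∀ ℓ' ∈ (c * ℓ).primeFactors, ¬ Jetchev2008.PlaceOver K (Sum.inr q : Place K) ℓ' := by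
    rintro ℓ' hℓ' ⟨𝔳, h𝔳, hℓ'𝔳⟩
    have hq𝔳 : q = 𝔳 := Sum.inr_injective h𝔳
    subst hq𝔳
    have hcopN : Nat.Coprime ℓ' (W.conductorNorm ℤ) :=
      (Nat.Prime.coprime_iff_not_dvd (Nat.prime_of_mem_primeFactors hℓ')).mpr (hcℓK ℓ' hℓ').1.2.1
    exact Literature.NumberTheory.NumberFields.Honda1971.natCast_notMem_of_coprime hcopN _ hℓ'𝔳 hqN
  exact localization_kolyvaginClass_mem_stringentFamily_of_GZ31_kolyvagin hK hD3 hD4 hH hp2 hρ Dt β ι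
    hcop' hGZ hcℓ hn hcℓK d' (Sum.inr q) hv



end Summit.BirchSwinnertonDyer.Rank1Residual.JET

end
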